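import Mathlib
import Literature.Combinatorics.Optimization.CorrelationPolytopeGridMinor
import Literature.Barriers.PneNP.ExtendedFormulationMinkowskiFaces
import Summits.ValiantsHypothesis.ValiantsHypothesis.Theorems.FifoMatchingNFPolytopeQueueGridCorProjection
import Summits.ValiantsHypothesis.ValiantsHypothesis.Theorems.FifoMatchingXcDivisionZmixCorHard
import Summits.ValiantsHypothesis.ValiantsHypothesis.Theorems.FifoMatchingXcDivisionChamberCertificate
import Summits.ValiantsHypothesis.ValiantsHypothesis.Theorems.FifoMatchingNNDivisionHardLocatedFaceExposure
import HarnessLib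

/-!
# STUB B IS A THEOREM — the sparse-difference passenger law `SparseEdgePassengerLaw` (line `virtual_passenger`, class B of
# crux `Theses.FifoMatching.NNDivisionHard`, stmt-ValiantsHypothesis-21181): CLASS B ⊆ CLASS E

Theorems-side port (port hand val-port-1 g3, director-valiant g16 RULING R290 (1); `--supports stmt-ValiantsHypothesis-21181 --as
helper`) of §3b of the line of record `Cruxes/NNDivisionHard/Lines/virtual_passenger.lean` (rev 4 @36f85308f73f, pen val-idea-42 g0;
critic of record val-idea-crit-9 g0 READ ✓ 19:07:59Z), together with the line's `rate_of_lvl` (§3), proof texts token-for-token modulo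
the spellings below.  STATEMENT of ★ `sparseEdgePassengerLaw_holds` = the line's `Gadget.SparseEdgePassengerLaw` δ-UNFOLDED
(`indexSupport d` ↦ `Finset.univ.filter fun z => ∃ z', d (z, z') ≠ 0 ∨ d (z', z) ≠ 0`; `T c h` ↦ `2 ^ ((Nat.log 2 h + c) ^ c)`), so the
line's `theorem sparseEdgePassengerLaw : SparseEdgePassengerLaw` can close by `exact` on this decl (rev-5 δ-wire, pen idea-42).

DEFINITION-FREE spellings (crux workfiles are not importable from `Theorems/`, and no `def` should enter `Theorems/` for a port):
`lvl h` ↦ `Nat.sqrt h - 2`; the equi-block map `eqβ h p = ⟨min (p / (h / (lvl h + 1))) (lvl h), _⟩` and its two lemmas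
(`eqβ_section`, `blockSize_le_card_block`) are packaged as ONE existential `exists_equiBlock` (a block map onto `Fin (lvl h + 1)` with a
section, every block of size `≥ h / (lvl h + 1)`); `BlockBlind h q` / `Blocks38.BlockConstSymGen` / `Blocks38.Jdir` are spelled out exactly
as in val-np-p6 g16's port of the class-E rung (`…Theorems.FifoMatching.LocatedFaceExposure.locatedFaceExposureRung_holds`, imported).

MECHANISM (val-idea-42 g0, rev 4): for `h ≥ 1` the equi-block map `[h] → [lvl h + 1]` has blocks of size `≥ h/(lvl h+1) ≥ √h >
log₂ log₂ h` (`sqrt_le_blockSize`, `loglog_lt_sqrt`); a symmetric block-constant difference `d` with a nonzero entry `d (p, q)` is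
nonzero at `(p', q)` for the whole block of `p`, so its index support has `≥ √h > log₂ log₂ h` elements — under the sparse-difference
hypothesis every such `d` vanishes (`= 0 • J`): ★ `blockBlind_of_sparseDiff` (class B ⊆ class E).  Then the class-E rung (np-p6's port)
gives `COR(K_{lvl h+1}) + (segment or point)` with an EF of size `r`, PROP A at `K = 2` (`XcDivision.corPolytopeGraph_top_add_hull_three_pow_le`,
port `…FifoMatchingXcDivisionChamberCertificate`) gives `(3/2)^{lvl h+1} ≤ 2(r+1)`, and ★ `rate_of_lvl` (`(3/2)^{lvl h} ≤ 2(r+1) ⇒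
2^((log₂ h + c)^c) < r` eventually; ✓ `QueueGridFace.growth_eventually` + ✓ `XcDivision.T_pow_four_le`) concludes.

HONEST FRAMING: this decides CLASS B (sparse-difference passenger families) of the line's exhaustive partition of COR-VIRTUAL — a
restriction; stmt-21181 `NNDivisionHard` is OPEN (the line rests on the open core `stub_gadgetSaturatedBudgetedLaw`); COR-VIRTUAL is
OPEN; `VP ≠ VNP` is NOT proved; nothing here is a summit statement.
-/

set_option autoImplicit false

-- the mandated summit-side namespace repeats a component by design (single-problem summit)
set_option linter.dupNamespace false

noncomputable section

open scoped Pointwise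

namespace Summit.ValiantsHypothesis.ValiantsHypothesis.Theorems.FifoMatching

namespace SparseEdgePassenger

open Literature.Barriers.PneNP (HasEFOfSize)
open Literature.Combinatorics.Optimization (corPolytopeGraph)
open Summit.ValiantsHypothesis.ValiantsHypothesis.Theorems.FifoMatching.QueueGridFace (growth_eventually)
open Summit.ValiantsHypothesis.ValiantsHypothesis.Theorems.FifoMatching.XcDivision (T_pow_four_le
  corPolytopeGraph_top_add_hull_three_pow_le)

/-! ## The rate of the read level `lvl h = ⌊√h⌋ − 2` (the line's `rate_of_lvl`, `lvl`/`T` spelled out) -/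

/-- **the rate of the decided classes is the route's (PROVED)**: `(3/2)^{⌊√h⌋−2} ≤ 2(r + 1) ⇒ 2^((log₂ h + c)^c) < r`
eventually in `h` (the line's `rate_of_lvl` with `lvl h = Nat.sqrt h - 2` and `T c h = 2 ^ ((Nat.log 2 h + c) ^ c)` unfolded). -/
theorem rate_of_lvl (c : ℕ) : ∃ h₀ : ℕ, ∀ h ≥ h₀, ∀ r : ℕ,
    (3 / 2 : ℝ) ^ (((Nat.sqrt h - 2 : ℕ) : ℕ) : ℝ) ≤ 2 * (r + 1) → 2 ^ ((Nat.log 2 h + c) ^ c) < r := by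
  obtain ⟨r₀, hr₀2, hgrowth⟩ := growth_eventually (4 ^ (c + 1) + c + 1) (c := (1 / 2 : ℝ)) (by norm_num)
  refine ⟨(max r₀ 4 + 3) ^ 2, fun h hh r hr => ?_⟩
  obtain ⟨s, hs⟩ : ∃ s, s = Nat.sqrt h := ⟨_, rfl⟩
  have hsR : max r₀ 4 + 3 ≤ s := by rw [hs]; exact Nat.le_sqrt'.2 hh
  have hns : h < (s + 1) * (s + 1) := by rw [hs]; exact Nat.lt_succ_sqrt h
  obtain ⟨m, hm⟩ : ∃ m, m = Nat.sqrt h - 2 := ⟨_, rfl⟩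
  have hm1 : s = m + 2 := by
    have := le_max_right r₀ 4
    rw [hm, ← hs]; omega
  have hm4 : 4 ≤ m := by
    have := le_max_right r₀ 4
    omega
  have hmr : r₀ ≤ m := by
    have := le_max_left r₀ 4
    omega
  rw [hm1] at hns
  have h16 : 4 * 4 ≤ m * m := Nat.mul_le_mul hm4 hm4
  have hsm : (m + 2 + 1) * (m + 2 + 1) ≤ m ^ 4 :=
    calc (m + 2 + 1) * (m + 2 + 1) = (m + 3) * (m + 3) := by ring
      _ ≤ (4 * m) * (4 * m) := Nat.mul_le_mul (by omega) (by omega)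
      _ = 16 * (m * m) := by ring
      _ ≤ (m * m) * (m * m) := Nat.mul_le_mul_right _ h16
      _ = m ^ 4 := by ring
  have hn4 : h < m ^ 4 := lt_of_lt_of_le hns hsm
  have hn0 : h ≠ 0 := by
    have : 0 < (max r₀ 4 + 3) ^ 2 := by positivity
    omega
  have hT := T_pow_four_le (c := c) hn0 hn4
  have hg := hgrowth m hmr
  -- `2 · 2^{(1/2)⌊m/2⌋} ≤ 2^{m/2} ≤ (3/2)^m`
  have hmono : 2 * (2 : ℝ) ^ ((1 / 2 : ℝ) * ((m / 2 : ℕ) : ℝ)) ≤ (2 : ℝ) ^ ((1 / 2 : ℝ) * (m : ℝ)) := by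
    have h21 : 2 * (2 : ℝ) ^ ((1 / 2 : ℝ) * ((m / 2 : ℕ) : ℝ)) = (2 : ℝ) ^ (1 + (1 / 2 : ℝ) * ((m / 2 : ℕ) : ℝ)) := by
      rw [Real.rpow_add (by norm_num), Real.rpow_one]
    rw [h21]
    apply Real.rpow_le_rpow_of_exponent_le (by norm_num)
    have h2 : (((m / 2 : ℕ) : ℝ)) * 2 ≤ (m : ℝ) := by exact_mod_cast Nat.div_mul_le_self m 2
    have h4 : (4 : ℝ) ≤ m := by exact_mod_cast hm4
    linarith
  have hsqrt : (2 : ℝ) ^ (1 / 2 : ℝ) ≤ 3 / 2 := by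
    rw [← Real.sqrt_eq_rpow]
    have h2 := Real.sq_sqrt (show (0 : ℝ) ≤ 2 by norm_num)
    nlinarith [Real.sqrt_nonneg 2]
  have h32 : (2 : ℝ) ^ ((1 / 2 : ℝ) * (m : ℝ)) ≤ (3 / 2 : ℝ) ^ ((m : ℕ) : ℝ) := by
    rw [Real.rpow_mul (by norm_num), Real.rpow_natCast, Real.rpow_natCast]
    exact pow_le_pow_left₀ (by positivity) hsqrt m
  rw [← hm] at hr
  have hpos : (1 : ℝ) ≤ 4 * (m : ℝ) ^ 4 := by
    have h1m : (1 : ℝ) ≤ m := by exact_mod_cast (show 1 ≤ m by omega)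
    have h14 : (1 : ℝ) ≤ (m : ℝ) ^ 4 := by
      have := pow_le_pow_left₀ zero_le_one h1m 4
      simpa using this
    linarith
  have hr1 : (2 : ℝ) ^ ((1 / 2 : ℝ) * ((m / 2 : ℕ) : ℝ)) ≤ r + 1 := by linarith
  have hlt : (((2 ^ ((Nat.log 2 m + (4 ^ (c + 1) + c + 1)) ^ (4 ^ (c + 1) + c + 1)) : ℕ) : ℕ) : ℝ) < r := by
    push_cast
    linarith
  have hlt' : 2 ^ ((Nat.log 2 m + (4 ^ (c + 1) + c + 1)) ^ (4 ^ (c + 1) + c + 1)) < r := by exact_mod_cast hlt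
  calc 2 ^ ((Nat.log 2 h + c) ^ c) ≤ (2 ^ ((Nat.log 2 h + c) ^ c)) ^ 4 := Nat.le_self_pow (by norm_num) _
    _ ≤ 2 ^ ((Nat.log 2 m + (4 ^ (c + 1) + c + 1)) ^ (4 ^ (c + 1) + c + 1)) := hT
    _ < r := hlt'

/-! ## CLASS B ⊆ CLASS E (the line's §3b): sparse-difference families are block-blind for the equi-block map -/

/-- `lvl h + 1 ≤ √h` for `h ≥ 1`. -/
theorem lvl_succ_le_sqrt (h : ℕ) (hh : 1 ≤ h) : Nat.sqrt h - 2 + 1 ≤ Nat.sqrt h := by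
  have : 1 ≤ Nat.sqrt h := Nat.le_sqrt.2 (by simpa using hh)
  omega

/-- the equi-block size `B = h / (lvl h + 1)` is at least `√h`. -/
theorem sqrt_le_blockSize (h : ℕ) (hh : 1 ≤ h) : Nat.sqrt h ≤ h / (Nat.sqrt h - 2 + 1) := by
  have hL := lvl_succ_le_sqrt h hh
  have hpos : 0 < Nat.sqrt h - 2 + 1 := Nat.succ_pos _
  refine (Nat.le_div_iff_mul_le hpos).2 ?_
  calc Nat.sqrt h * (Nat.sqrt h - 2 + 1) ≤ Nat.sqrt h * Nat.sqrt h := Nat.mul_le_mul_left _ hL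
    _ ≤ h := Nat.sqrt_le h

/-- `(s+1)² ≤ 2^(2^s)`. -/
theorem sq_succ_le_two_pow_two_pow (s : ℕ) : (s + 1) ^ 2 ≤ 2 ^ (2 ^ s) := by
  -- `2s ≤ 2^s` (the line's `two_mul_le_two_pow`, in place — the tree already has this lemma under an elliptic-curves module)
  have h2 : 2 * s ≤ 2 ^ s := by
    induction s with
    | zero => simp
    | succ k ih =>
      have : 1 ≤ 2 ^ k := Nat.one_le_two_pow
      rw [pow_succ]
      omega
  have h1 : s + 1 ≤ 2 ^ s := Nat.lt_two_pow_self
  calc (s + 1) ^ 2 ≤ (2 ^ s) ^ 2 := Nat.pow_le_pow_left h1 2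
    _ = 2 ^ (2 * s) := by rw [← pow_mul, mul_comm]
    _ ≤ 2 ^ (2 ^ s) := Nat.pow_le_pow_right (by norm_num) h2

/-- `log₂ log₂ h < √h` for `h ≥ 1`. -/
theorem loglog_lt_sqrt (h : ℕ) (hh : 1 ≤ h) : Nat.log 2 (Nat.log 2 h) < Nat.sqrt h := by
  set s := Nat.sqrt h with hs
  have hlt : h < 2 ^ (2 ^ s) := lt_of_lt_of_le (Nat.lt_succ_sqrt h) (by
    have := sq_succ_le_two_pow_two_pow s
    simpa [pow_two, Nat.succ_eq_add_one] using this)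
  have h1 : Nat.log 2 h < 2 ^ s := Nat.log_lt_of_lt_pow (by omega) hlt
  by_cases h0 : Nat.log 2 h = 0
  · rw [h0, Nat.log_zero_right]
    exact Nat.le_sqrt.2 (by simpa using hh)
  · exact Nat.log_lt_of_lt_pow h0 h1

/-- **the equi-block map** (the line's `eqβ h p = ⟨min (p / B) (lvl h), _⟩`, `B = h / (lvl h + 1)`, with `eqβ_section` and
`blockSize_le_card_block`, packaged): for `h ≥ 1` there is a block map `[h] → [lvl h + 1]` with a section `t ↦ t·B`, every block of
which has at least `B = h / (lvl h + 1)` elements. -/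
theorem exists_equiBlock (h : ℕ) (hh : 1 ≤ h) :
    ∃ (β : Fin h → Fin (Nat.sqrt h - 2 + 1)) (ρ : Fin (Nat.sqrt h - 2 + 1) → Fin h), (∀ t, β (ρ t) = t) ∧
      ∀ p₀ : Fin h, h / (Nat.sqrt h - 2 + 1) ≤ (Finset.univ.filter fun p : Fin h => β p = β p₀).card := by
  classical
  obtain ⟨L, hL⟩ : ∃ L, L = Nat.sqrt h - 2 := ⟨_, rfl⟩
  rw [← hL]
  set B := h / (L + 1) with hB
  -- the line's `eqβ`
  let eqβ : Fin h → Fin (L + 1) := fun p => ⟨min (p.val / B) L, by omega⟩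
  have hB1 : 1 ≤ B := by
    rw [hB, hL]
    exact le_trans (Nat.le_sqrt.2 (by simpa using hh)) (sqrt_le_blockSize h hh)
  have hLB : (L + 1) * B ≤ h := Nat.mul_div_le h (L + 1)
  refine ⟨eqβ, fun t => ⟨t.val * B, ?_⟩, fun t => ?_, fun p₀ => ?_⟩
  · -- the line's `eqβ_section`, range
    have ht := t.isLt
    calc t.val * B < (L + 1) * B := Nat.mul_lt_mul_of_pos_right ht (by omega)
      _ ≤ h := hLB
  · -- the line's `eqβ_section`, section property
    apply Fin.ext
    show min ((t.val * B) / B) L = t.val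
    rw [Nat.mul_div_cancel _ (by omega)]
    exact min_eq_left (by have := t.isLt; omega)
  · -- the line's `blockSize_le_card_block`
    set t := (eqβ p₀).val with ht
    have htle : t ≤ L := by have := (eqβ p₀).isLt; omega
    -- the elements `t*B + i`, `i < B`, lie in the block of `p₀`
    have hlt : ∀ i < B, t * B + i < h := by
      intro i hi
      calc t * B + i < t * B + B := by omega
        _ = (t + 1) * B := by ring
        _ ≤ (L + 1) * B := Nat.mul_le_mul_right _ (by omega)
        _ ≤ h := hLB
    let f : Fin B → Fin h := fun i => ⟨t * B + i.val, hlt i.val i.isLt⟩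
    have hf : Function.Injective f := by
      intro i i' hii'
      apply Fin.ext
      have := congrArg Fin.val hii'
      simp only [f] at this
      omega
    have hmem : ∀ i : Fin B, f i ∈ Finset.univ.filter fun p : Fin h => eqβ p = eqβ p₀ := by
      intro i
      refine Finset.mem_filter.2 ⟨Finset.mem_univ _, ?_⟩
      apply Fin.ext
      show min ((t * B + i.val) / B) L = t
      have hdiv : (t * B + i.val) / B = t :=
        Nat.div_eq_of_lt_le (by omega) (by rw [Nat.succ_mul]; have := i.isLt; omega)
      rw [hdiv]
      exact min_eq_left htle
    calc B = (Finset.univ : Finset (Fin B)).card := by simp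
      _ = ((Finset.univ : Finset (Fin B)).image f).card := (Finset.card_image_of_injective _ hf).symm
      _ ≤ _ := Finset.card_le_card (by intro x hx; obtain ⟨i, -, rfl⟩ := Finset.mem_image.1 hx; exact hmem i)

/-- ★ **CLASS B ⊆ CLASS E** (the line's `blockBlind_of_sparseDiff`, with `SparseDiff` / `BlockBlind` / `BlockConstSymGen` / `Jdir`
spelled out): for `h ≥ 1`, a passenger family all of whose vertex differences touch `≤ log₂ log₂ h` indices is block-blind for the
equi-block map — every symmetric block-constant vertex difference is `0 • J`. -/
theorem blockBlind_of_sparseDiff (h : ℕ) (hh : 1 ≤ h) {K : ℕ} (q : Fin (K + 1) → (Fin h × Fin h → ℝ))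
    (hS : ∀ j j', (Finset.univ.filter fun z : Fin h =>
      ∃ z', (q j - q j') (z, z') ≠ 0 ∨ (q j - q j') (z', z) ≠ 0).card ≤ Nat.log 2 (Nat.log 2 h)) :
    ∃ (β : Fin h → Fin (Nat.sqrt h - 2 + 1)) (ρ : Fin (Nat.sqrt h - 2 + 1) → Fin h), (∀ t, β (ρ t) = t) ∧
      ∀ j j', ((∀ p p', (q j - q j') (p, p') = (q j - q j') (p', p)) ∧
          ∀ p p' p'' p''', β p = β p'' → β p' = β p''' → (q j - q j') (p, p') = (q j - q j') (p'', p''')) →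
        ∃ α : ℝ, q j - q j' = α • (fun _ : Fin h × Fin h => (1 : ℝ)) := by
  classical
  obtain ⟨β, ρ, hρ, hblock⟩ := exists_equiBlock h hh
  refine ⟨β, ρ, hρ, fun j j' hgen => ⟨0, ?_⟩⟩
  rw [zero_smul]
  funext pq
  obtain ⟨p, q₁⟩ := pq
  by_contra hne
  -- the whole block of `p` lies in the index support of the difference
  have hsub : (Finset.univ.filter fun p' : Fin h => β p' = β p) ⊆
      (Finset.univ.filter fun z : Fin h => ∃ z', (q j - q j') (z, z') ≠ 0 ∨ (q j - q j') (z', z) ≠ 0) := by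
    intro p' hp'
    have hp'β := (Finset.mem_filter.1 hp').2
    refine Finset.mem_filter.2 ⟨Finset.mem_univ _, q₁, Or.inl ?_⟩
    rw [← hgen.2 p q₁ p' q₁ hp'β.symm rfl]
    exact hne
  have h1 := Finset.card_le_card hsub
  have h2 := hblock p
  have h3 := hS j j'
  have h4 := loglog_lt_sqrt h hh
  have h5 := sqrt_le_blockSize h hh
  omega

/-- ★★ **STUB B IS A THEOREM** (the line's `sparseEdgePassengerLaw_holds`; statement = `Gadget.SparseEdgePassengerLaw` δ-unfolded):
the sparse-difference passenger law holds — class B is contained in class E (`blockBlind_of_sparseDiff`), which the located-face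
exposure rung (`LocatedFaceExposure.locatedFaceExposureRung_holds`) and PROP A at `K = 2` decide at the route rate (`rate_of_lvl`). -/
theorem sparseEdgePassengerLaw_holds :
    ∀ c : ℕ, ∃ h₀ : ℕ, ∀ h ≥ h₀, ∀ (K : ℕ) (q : Fin (K + 1) → (Fin h × Fin h → ℝ)) (r : ℕ),
      (∀ j j', (Finset.univ.filter fun z =>
        ∃ z', (q j - q j') (z, z') ≠ 0 ∨ (q j - q j') (z', z) ≠ 0).card ≤ Nat.log 2 (Nat.log 2 h)) →
      HasEFOfSize (corPolytopeGraph (⊤ : SimpleGraph (Fin h)) + convexHull ℝ (Set.range q)) r →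
        2 ^ ((Nat.log 2 h + c) ^ c) < r := by
  intro c
  obtain ⟨h₁, hh₁⟩ := rate_of_lvl c
  refine ⟨max h₁ 1, fun h hh K q r hS hEF => ?_⟩
  have hh1 : h₁ ≤ h := le_trans (le_max_left _ _) hh
  have hh2 : 1 ≤ h := le_trans (le_max_right _ _) hh
  -- class B ⊆ class E; the class-E rung; PROP A at `K = 2` (the line's `blockBlind_three_halves_pow_le`)
  obtain ⟨β, ρ, hρ, hal⟩ := blockBlind_of_sparseDiff h hh2 q hS
  obtain ⟨q', hq'⟩ := LocatedFaceExposure.locatedFaceExposureRung_holds h (Nat.sqrt h - 2 + 1) β ρ hρ K q r hal hEF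
  have hA := corPolytopeGraph_top_add_hull_three_pow_le q' two_pos hq'
  have hAR : (3 / 2 : ℝ) ^ (Nat.sqrt h - 2 + 1) ≤ 2 * (r + 1) := by
    rw [div_pow, div_le_iff₀ (by positivity)]
    have : ((3 ^ (Nat.sqrt h - 2 + 1) : ℕ) : ℝ) ≤ ((2 * (r + 1) * 2 ^ (Nat.sqrt h - 2 + 1) : ℕ) : ℝ) := by
      exact_mod_cast hA
    push_cast at this
    linarith
  refine hh₁ h hh1 r ?_
  rw [Real.rpow_natCast]
  exact le_trans (pow_le_pow_right₀ (by norm_num) (Nat.le_succ _)) hAR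

end SparseEdgePassenger

end Summit.ValiantsHypothesis.ValiantsHypothesis.Theorems.FifoMatching

end
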